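import Literature.Analysis.FluidPDE.PeriodicCylinderInteriorWords
import HarnessLib

/-!
# Interior regularity on the period cell: all orders

Topic `Literature/Analysis/FluidPDE`. Support file (all results proved, no definitions, no named
facts): the general-order version of the interior estimate of `PeriodicCylinderInteriorWords`
(there: constant words of length `≤ 4` on `{r < 1/2}`, the order of Ferrari's `H³` pressure
estimate). For `q` smooth on the closed cylinder and `L`-periodic, every constant-direction word
`∂_{v₁}⋯∂_{v_n} q`, `1 ≤ n ≤ K + 2`, is bounded in `L²(cell ∩ {r < 1/2})` by the constant words of
`Δ_K q` of length `≤ K` and `‖∇q‖` (`exists_cellL2In_half_le_all`). The step (`cellL2In_step_all`)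
is the proof of `cellL2In_step` verbatim with the data size `Σ_{m ≤ K}` in place of `Σ_{m ≤ 2}`
(radial cutoff, interior Hessian identity `Σ‖∂ᵢ∂ⱼv‖² = ‖Δ_K v‖²`, Leibniz for `Δ_K(χh)`, Poincaré on
the cell); the iteration uses the radii `ρ_k = 1/2 + 4⁻¹2⁻ᵏ`. This is the interior part of the
general-order `H^k` estimate for the Neumann problem on the periodic cylinder (T. Kato, C. Y. Lai,
J. Funct. Anal. 56 (1984) §4 (i), "`P` maps `H^s` into itself"; the analytic input of
`Literature.Analysis.FluidPDE.KatoLai1984_periodicCylinderUniformExistence`). All statements are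
folklore calculus (interior elliptic regularity, e.g. L. C. Evans, *PDE*, §6.3.1 Thm 2).

Mathlib/tree search: everything from `PeriodicCylinderInteriorWords` (`cellL2In_step`,
`cellL2In_combine`, `cellL2In_cylDeriv_le`, `cylRadialCutoff`, `cellL2_hessian_le`); no general-order
interior estimate existed (`lean search 'cellL2In'`).

## References

* T. Kato, C. Y. Lai, J. Funct. Anal. 56 (1984) 15–28, §4 (i). [KatoLai1984]
* L. C. Evans, *Partial Differential Equations*, 2nd ed. (2010), §6.3.1. [Evans2010]
-/

noncomputable section

open MeasureTheory Set Function Filter Topology TopologicalSpace WithLp Metric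
open scoped ContDiff NNReal ENNReal InnerProductSpace RealInnerProductSpace

namespace Literature.Analysis.FluidPDE

open Literature.Analysis.FunctionSpaces

/-- Local notation for physical space `ℝ³ = EuclideanSpace ℝ (Fin 3)`. -/
local notation "ℝ³" => EuclideanSpace ℝ (Fin 3)

/-- Local notation for the closed unit cylinder `{r ≤ 1}`. -/
local notation "𝕂" => closure (SetLike.coe unitCylinder : Set (EuclideanSpace ℝ (Fin 3)))

section Interior

variable {L : ℝ} (hL : 0 < L) {M : ℝ} (hM1 : 1 ≤ M)

include hL hM1

/-- **The step of the interior induction, general data order.** Let `0 < ρ₁ < ρ₀ ≤ 1`, `k ≤ K`, and suppose the constant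
words of `q` of lengths `1, …, k+1` (letters of norm `≤ M`) are bounded on `{r < ρ₀}` by `C_k 𝒟(q)`,
where `𝒟(q) = Σ_{m ≤ K} Σ_w cellL2 (X_{e∘w} Δ_K q) + cellL2 (∇q)` (verbatim the proof of
`cellL2In_step`, whose data size stops at `m ≤ 2`). Then the constant words of length
`k + 2` are bounded on `{r < ρ₁}` by `C 𝒟(q)`. Proof: for the word `∂_a∂_b X_{vs'}`, put
`h = X_{vs'}(q − ⨍q)`, `χ = cylRadialCutoff ρ₁ ρ*` (`ρ* = (ρ₁+ρ₀)/2`), `v = χ h`; on `{r < ρ₁}` the word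
is `∂_a∂_b v` (locality), `‖∂_a∂_b v‖ ≤ 9M²‖Δ_K v‖` (interior Hessian identity, `v` vanishes near the
wall), and `Δ_K v = χ X_{vs'}Δ_K q + 2Σᵢ ∂ᵢχ ∂ᵢh + (Δ_K χ) h` is controlled on `{r < ρ₀}` by the data,
the induction hypothesis and (for `k = 0`) the Poincaré inequality on the cell. [folklore] -/
theorem cellL2In_step_all {ρ₁ ρ₀ : ℝ} (hρ₁ : 0 < ρ₁) (h10 : ρ₁ < ρ₀) (hρ₀ : ρ₀ ≤ 1)
    (K k : ℕ) (hk : k ≤ K) {Ck : ℝ} (hCk : 0 ≤ Ck) :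
    ∃ C : ℝ, 0 ≤ C ∧ ∀ (q : ℝ³ → ℝ), ContDiffOn ℝ ∞ q 𝕂 → IsAxiallyPeriodic L q →
      (∀ vs : List ℝ³, 1 ≤ vs.length → vs.length ≤ k + 1 → (∀ v ∈ vs, ‖v‖ ≤ M) →
        cellL2In L ρ₀ (cylWord (jcWord (vs.map some)) q) ≤
          Ck * (∑ m ∈ Finset.range (K + 1), ∑ w : Fin m → Fin (Module.finrank ℝ ℝ³),
            cellL2 L (cylWord (jcWord (constWord fun j => Module.finBasis ℝ ℝ³ (w j))) (cylLap q)) + cellL2 L (cylGrad q))) →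
      ∀ vs : List ℝ³, vs.length = k + 2 → (∀ v ∈ vs, ‖v‖ ≤ M) →
        cellL2In L ρ₁ (cylWord (jcWord (vs.map some)) q) ≤
          C * (∑ m ∈ Finset.range (K + 1), ∑ w : Fin m → Fin (Module.finrank ℝ ℝ³),
            cellL2 L (cylWord (jcWord (constWord fun j => Module.finBasis ℝ ℝ³ (w j))) (cylLap q)) + cellL2 L (cylGrad q)) := by
  have hM0 : 0 ≤ M := zero_le_one.trans hM1
  set b := Module.finBasis ℝ ℝ³ with hb
  set Λ : ℝ := ∑ k, ‖LinearMap.toContinuousLinearMap (b.coord k)‖ with hΛ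
  have hΛ0 : 0 ≤ Λ := Finset.sum_nonneg fun k _ => norm_nonneg _
  -- the cutoff and its bounds
  set ρs : ℝ := (ρ₁ + ρ₀) / 2 with hρs
  have hρ1s : ρ₁ < ρs := by rw [hρs]; linarith
  have hρs0 : ρs < ρ₀ := by rw [hρs]; linarith
  set χ : ℝ³ → ℝ := cylRadialCutoff ρ₁ ρs with hχ
  obtain ⟨A, hA0, hA⟩ := exists_bound_cylDeriv_cylRadialCutoff ρ₁ ρs
  obtain ⟨B, hB0, hB⟩ := exists_bound_cylLap_cylRadialCutoff ρ₁ ρs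
  obtain ⟨CP, hCP0, hCP⟩ := exists_cellL2_sub_average_le hL
  -- the constant
  refine ⟨9 * M ^ 2 * ((Λ * M) ^ k + 6 * A * Ck + B * (Ck + CP)), by positivity, ?_⟩
  intro q hq hqp IH vs hvs hletters
  -- notation for the data
  set 𝒟 : ℝ := (∑ m ∈ Finset.range (K + 1), ∑ w : Fin m → Fin (Module.finrank ℝ ℝ³),
    cellL2 L (cylWord (jcWord (constWord fun j => b (w j))) (cylLap q)) + cellL2 L (cylGrad q)) with h𝒟
  have h𝒟0 : 0 ≤ 𝒟 := add_nonneg (Finset.sum_nonneg fun m _ => Finset.sum_nonneg fun w _ => cellL2_nonneg L _)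
    (cellL2_nonneg L _)
  -- decompose the word
  obtain ⟨a, vs₁, rfl⟩ := List.exists_of_length_succ vs hvs
  have hvs₁ : vs₁.length = k + 1 := by simpa using hvs
  obtain ⟨a', vs', rfl⟩ := List.exists_of_length_succ vs₁ hvs₁
  have hvs' : vs'.length = k := by simpa using hvs₁
  have ha : ‖a‖ ≤ M := hletters a (by simp)
  have ha' : ‖a'‖ ≤ M := hletters a' (by simp)
  have hl' : ∀ v ∈ vs', ‖v‖ ≤ M := fun v hv => hletters v (by simp [hv])
  -- the functions `q̃`, `h`, `v`
  set qt : ℝ³ → ℝ := fun y => q y - ⨍ y in (cylinderCell L : Set ℝ³), q y with hqt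
  have hqt_s : ContDiffOn ℝ ∞ qt 𝕂 := hq.sub contDiffOn_const
  have hqt_p : IsAxiallyPeriodic L qt := fun x => by simp only [hqt, hqp x]
  set h : ℝ³ → ℝ := cylWord (jcWord (vs'.map some)) qt with hh
  have hh_s : ContDiffOn ℝ ∞ h 𝕂 := contDiffOn_cylWord_jcWord _ hqt_s
  have hh_p : IsAxiallyPeriodic L h := isAxiallyPeriodic_cylWord_const vs' hqt_p
  have hχ_s : ContDiffOn ℝ ∞ χ 𝕂 := (contDiff_cylRadialCutoff ρ₁ ρs).contDiffOn
  set v : ℝ³ → ℝ := fun y => χ y • h y with hv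
  have hv_s : ContDiffOn ℝ ∞ v 𝕂 := hχ_s.smul hh_s
  have hv_p : IsAxiallyPeriodic L v := fun x => by
    simp only [hv]
    rw [hh_p x, hχ, isAxiallyPeriodic_cylRadialCutoff L ρ₁ ρs x]
  -- `v` vanishes on `{r > ρ*}`, hence its derivatives vanish on the wall
  have hv0 : ∀ y ∈ 𝕂, ρs < cylRadius y → v y = 0 := fun y _ hy => by
    simp only [hv, hχ, cylRadialCutoff_eq_zero hρ₁ hρ1s hy.le, zero_smul]
  have hwallr : ∀ x ∈ frontier (unitCylinder : Set ℝ³), x ∈ 𝕂 ∧ ρs < cylRadius x := fun x hx => by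
    refine ⟨frontier_subset_closure hx, ?_⟩
    rw [frontier_unitCylinder] at hx
    rw [show cylRadius x = 1 from hx]
    linarith
  have hw1 : ∀ (c : ℝ³), ∀ x ∈ frontier (unitCylinder : Set ℝ³), cylDeriv (fun _ => c) v x = 0 := fun c x hx =>
    cylDeriv_eq_zero_of_eqOn_zero _ hv0 (hwallr x hx).1 (hwallr x hx).2
  have hw2 : ∀ (c d : ℝ³), ∀ x ∈ frontier (unitCylinder : Set ℝ³),
      cylDeriv (fun _ => c) (cylDeriv (fun _ => d) v) x = 0 := fun c d x hx =>
    cylDeriv_eq_zero_of_eqOn_zero _ (cylDeriv_vanish_of_vanish _ hv0) (hwallr x hx).1 (hwallr x hx).2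
  -- step 1: on `{r < ρ₁}` the word is `∂_a ∂_a' v`
  have step1 : cellL2In L ρ₁ (cylWord (jcWord ((a :: a' :: vs').map some)) q) ≤
      cellL2 L (cylDeriv (fun _ => a) (cylDeriv (fun _ => a') v)) := by
    have hvh : EqOn v h {x : ℝ³ | cylRadius x < ρ₁} := fun x hx => by
      simp only [hv, hχ, cylRadialCutoff_eq_one hρ₁ hρ1s (le_of_lt hx), one_smul]
    have hloc := cylWord_const_eqOn_of_eqOn (F := ℝ) (by linarith : ρ₁ ≤ 1) [a, a'] hvh
    have hword : cylWord (jcWord ((a :: a' :: vs').map some)) q = cylWord (jcWord ([a, a'].map some)) h := by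
      rw [hh, ← cylWord_const_sub_const' (a :: a' :: vs') (List.cons_ne_nil _ _) q
        (⨍ y in (cylinderCell L : Set ℝ³), q y)]
      rw [show (a :: a' :: vs') = [a, a'] ++ vs' from rfl, List.map_append, jcWord_append, cylWord_append]
    refine cellL2In_le_cellL2_of_eqOn L ρ₁
      (contDiffOn_cylDeriv contDiff_const (contDiffOn_cylDeriv contDiff_const hv_s)).continuousOn
      fun x _ hxr => ?_
    rw [hword, ← hloc hxr]
    rfl
  -- step 2: the Hessian of `v` by its Laplacian
  have step2 : cellL2 L (cylDeriv (fun _ => a) (cylDeriv (fun _ => a') v)) ≤ 9 * M ^ 2 * cellL2 L (cylLap v) := by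
    refine (cellL2_hessian_le hL hv_s hv_p hw1 hw2 a a').trans ?_
    have h1 : 9 * ‖a‖ * ‖a'‖ ≤ 9 * M ^ 2 := by nlinarith [norm_nonneg a, norm_nonneg a']
    exact mul_le_mul_of_nonneg_right h1 (cellL2_nonneg L _)
  -- step 3: the Laplacian of `v = χ h`
  have hdχ : ∀ i : Fin 3, ContDiffOn ℝ ∞ (cylDeriv (fun _ => cylBasis i) χ) 𝕂 := fun i => contDiffOn_cylDeriv contDiff_const hχ_s
  have hdh : ∀ i : Fin 3, ContDiffOn ℝ ∞ (cylDeriv (fun _ => cylBasis i) h) 𝕂 := fun i => contDiffOn_cylDeriv contDiff_const hh_s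
  have hT1 : ContinuousOn (fun x => χ x • cylLap h x) 𝕂 := (hχ_s.continuousOn).smul (contDiffOn_cylLap hh_s).continuousOn
  have hT2i : ∀ i : Fin 3, ContinuousOn (fun x => cylDeriv (fun _ => cylBasis i) χ x • cylDeriv (fun _ => cylBasis i) h x) 𝕂 :=
    fun i => (hdχ i).continuousOn.smul (hdh i).continuousOn
  have hT2 : ContinuousOn (fun x => (2 : ℝ) • ∑ i : Fin 3, cylDeriv (fun _ => cylBasis i) χ x • cylDeriv (fun _ => cylBasis i) h x) 𝕂 :=
    ((contDiffOn_const (c := (2 : ℝ))).smul (ContDiffOn.sum (s := Finset.univ) fun i _ => (hdχ i).smul (hdh i))).continuousOn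
  have hT3 : ContinuousOn (fun x => cylLap χ x • h x) 𝕂 := (contDiffOn_cylLap hχ_s).continuousOn.smul hh_s.continuousOn
  have step3 : cellL2 L (cylLap v) ≤ cellL2 L (fun x => χ x • cylLap h x) +
      cellL2 L (fun x => (2 : ℝ) • ∑ i : Fin 3, cylDeriv (fun _ => cylBasis i) χ x • cylDeriv (fun _ => cylBasis i) h x) +
      cellL2 L (fun x => cylLap χ x • h x) := by
    have hid : EqOn (cylLap v) (fun x => (χ x • cylLap h x +
        (2 : ℝ) • ∑ i : Fin 3, cylDeriv (fun _ => cylBasis i) χ x • cylDeriv (fun _ => cylBasis i) h x) +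
        cylLap χ x • h x) 𝕂 := fun x hx => cylLap_smul hχ_s hh_s hx
    have e1 : cellL2 L (cylLap v) = cellL2 L (fun x => (χ x • cylLap h x +
        (2 : ℝ) • ∑ i : Fin 3, cylDeriv (fun _ => cylBasis i) χ x • cylDeriv (fun _ => cylBasis i) h x) +
        cylLap χ x • h x) := by
      simp only [cellL2]
      congr 1
      exact eLpNorm_congr_ae (ae_restrict_of_forall_mem (cylinderCell L).isOpen.measurableSet
        fun x hx => hid (subset_closure (cylinderCell_le_unitCylinder L hx)))
    rw [e1]
    exact (cellL2_add_le L (hT1.add hT2) hT3).trans (add_le_add (cellL2_add_le L hT1 hT2) le_rfl)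
  -- step 3a: `χ Δ_K h` by the data
  have step3a : cellL2 L (fun x => χ x • cylLap h x) ≤ (Λ * M) ^ k * 𝒟 := by
    have hχ0 : ∀ x ∈ 𝕂, ρ₀ ≤ cylRadius x → χ x = 0 := fun x _ hx =>
      cylRadialCutoff_eq_zero hρ₁ hρ1s (hρs0.le.trans hx)
    have hχ1 : ∀ x ∈ 𝕂, |χ x| ≤ 1 := fun x _ => abs_cylRadialCutoff_le _ _ x
    refine (cellL2_smul_le_cellL2In L zero_le_one hχ0 hχ1 (contDiffOn_cylLap hh_s).continuousOn).trans ?_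
    rw [one_mul]
    -- `Δ_K h = X_{vs'} Δ_K q` on the closed cylinder
    have hLh : EqOn (cylLap h) (cylWord (jcWord (vs'.map some)) (cylLap q)) 𝕂 := by
      intro x hx
      rw [hh, cylLap_cylWord_const vs' hqt_s hx, hqt, cylLap_sub_const]
    have hWs : ContDiffOn ℝ ∞ (cylWord (jcWord (vs'.map some)) (cylLap q)) 𝕂 :=
      contDiffOn_cylWord_jcWord _ (contDiffOn_cylLap hq)
    calc cellL2In L ρ₀ (cylLap h) ≤ cellL2 L (cylWord (jcWord (vs'.map some)) (cylLap q)) :=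
          cellL2In_le_cellL2_of_eqOn L ρ₀ hWs.continuousOn fun x hx _ =>
            hLh (subset_closure (cylinderCell_le_unitCylinder L hx))
      _ ≤ cellL2 L (fun x => (Λ * M) ^ vs'.length * ∑ w : Fin vs'.length → Fin (Module.finrank ℝ ℝ³),
            ‖cylWord (jcWord (constWord fun j => b (w j))) (cylLap q) x‖) := by
          refine cellL2_mono L (continuousOn_const.mul (continuousOn_finsetSum _ fun w _ =>
            (contDiffOn_cylWord_jcWord _ (contDiffOn_cylLap hq)).continuousOn.norm)) fun x hx => ?_
          have hxK : x ∈ 𝕂 := subset_closure (cylinderCell_le_unitCylinder L hx)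
          rw [Real.norm_of_nonneg (mul_nonneg (by positivity) (Finset.sum_nonneg fun w _ => norm_nonneg _))]
          exact norm_cylWord_const_le_sum_basisWords hM0 vs' hl' (contDiffOn_cylLap hq) hxK
      _ ≤ (Λ * M) ^ k * ∑ w : Fin k → Fin (Module.finrank ℝ ℝ³),
            cellL2 L (cylWord (jcWord (constWord fun j => b (w j))) (cylLap q)) := by
          have hc : ∀ w : Fin k → Fin (Module.finrank ℝ ℝ³),
              ContinuousOn (fun x => ‖cylWord (jcWord (constWord fun j => b (w j))) (cylLap q) x‖) 𝕂 := fun w =>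
            (contDiffOn_cylWord_jcWord _ (contDiffOn_cylLap hq)).continuousOn.norm
          rw [hvs', cellL2_const_mul L (by positivity)]
          refine mul_le_mul_of_nonneg_left ?_ (by positivity)
          refine (cellL2_sum_le L _ fun w _ => hc w).trans (le_of_eq ?_)
          exact Finset.sum_congr rfl fun w _ => cellL2_norm L _
      _ ≤ (Λ * M) ^ k * 𝒟 := by
          refine mul_le_mul_of_nonneg_left ?_ (by positivity)
          have hk3 : k ∈ Finset.range (K + 1) := Finset.mem_range.2 (by omega)
          have h1 := Finset.single_le_sum (f := fun m => ∑ w : Fin m → Fin (Module.finrank ℝ ℝ³),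
            cellL2 L (cylWord (jcWord (constWord fun j => b (w j))) (cylLap q)))
            (fun m _ => Finset.sum_nonneg fun w _ => cellL2_nonneg L _) hk3
          have h2 := cellL2_nonneg L (cylGrad q)
          simp only [h𝒟]
          linarith
  -- the vanishing of `χ` and its derivatives on `{r ≥ ρ₀}`
  have hχ0' : ∀ y ∈ 𝕂, ρs < cylRadius y → χ y = 0 := fun y _ hy => cylRadialCutoff_eq_zero hρ₁ hρ1s hy.le
  have hdχ0 : ∀ (i : Fin 3), ∀ x ∈ 𝕂, ρ₀ ≤ cylRadius x → cylDeriv (fun _ => cylBasis i) χ x = 0 := fun i x hx hxr =>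
    cylDeriv_eq_zero_of_eqOn_zero _ hχ0' hx (lt_of_lt_of_le hρs0 hxr)
  have hLχ0 : ∀ x ∈ 𝕂, ρ₀ ≤ cylRadius x → cylLap χ x = 0 := fun x hx hxr => by
    rw [cylLap_apply]
    exact Finset.sum_eq_zero fun i _ =>
      cylDeriv_eq_zero_of_eqOn_zero _ (cylDeriv_vanish_of_vanish _ hχ0') hx (lt_of_lt_of_le hρs0 hxr)
  -- the induction hypothesis for `∂ᵢ h` and for `h`
  have hIHi : ∀ i : Fin 3, cellL2In L ρ₀ (cylDeriv (fun _ => cylBasis i) h) ≤ Ck * 𝒟 := by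
    intro i
    have hword : cylDeriv (fun _ => cylBasis i) h = cylWord (jcWord ((cylBasis i :: vs').map some)) q := by
      rw [hh, ← cylWord_const_cons, cylWord_const_sub_const' _ (List.cons_ne_nil _ _)]
    rw [hword]
    refine IH _ (by simp) (by simp [hvs']) fun v hv => ?_
    rcases List.mem_cons.1 hv with rfl | hv
    · rw [norm_cylBasis]; exact hM1
    · exact hl' v hv
  have hIHh : cellL2In L ρ₀ h ≤ (Ck + CP) * 𝒟 := by
    by_cases hnil : vs' = []
    · have hhq : h = qt := by rw [hh, hnil]; rfl
      rw [hhq]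
      calc cellL2In L ρ₀ qt ≤ cellL2 L qt := cellL2In_le_cellL2 L ρ₀ hqt_s.continuousOn
        _ ≤ CP * cellL2 L (cylGrad q) := hCP q hq
        _ ≤ CP * 𝒟 := by
            refine mul_le_mul_of_nonneg_left ?_ hCP0
            have := Finset.sum_nonneg (s := Finset.range (K + 1)) fun m _ => Finset.sum_nonneg (s := Finset.univ)
              fun (w : Fin m → Fin (Module.finrank ℝ ℝ³)) _ =>
                cellL2_nonneg L (cylWord (jcWord (constWord fun j => b (w j))) (cylLap q))
            simp only [h𝒟]; linarith
        _ ≤ (Ck + CP) * 𝒟 := by nlinarith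
    · have hword : h = cylWord (jcWord (vs'.map some)) q := by rw [hh, cylWord_const_sub_const' _ hnil]
      rw [hword]
      have hlen : 1 ≤ vs'.length := by
        rw [Nat.one_le_iff_ne_zero]; exact fun h0 => hnil (List.eq_nil_of_length_eq_zero h0)
      calc _ ≤ Ck * 𝒟 := IH vs' hlen (by rw [hvs']; omega) hl'
        _ ≤ (Ck + CP) * 𝒟 := by nlinarith
  -- step 3b: the cross term
  have step3b : cellL2 L (fun x => (2 : ℝ) • ∑ i : Fin 3, cylDeriv (fun _ => cylBasis i) χ x • cylDeriv (fun _ => cylBasis i) h x) ≤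
      6 * A * Ck * 𝒟 := by
    rw [cellL2_const_smul, abs_of_pos (by norm_num : (0 : ℝ) < 2)]
    have hAi : ∀ (i : Fin 3), ∀ x ∈ 𝕂, |cylDeriv (fun _ => cylBasis i) χ x| ≤ A := fun i x hx => by
      have h := hA (fun _ => cylBasis i) x hx
      rwa [norm_cylBasis, mul_one] at h
    calc 2 * cellL2 L (fun x => ∑ i : Fin 3, cylDeriv (fun _ => cylBasis i) χ x • cylDeriv (fun _ => cylBasis i) h x)
        ≤ 2 * ∑ i : Fin 3, cellL2 L (fun x => cylDeriv (fun _ => cylBasis i) χ x • cylDeriv (fun _ => cylBasis i) h x) :=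
          mul_le_mul_of_nonneg_left (cellL2_sum_le L _ fun i _ => hT2i i) (by norm_num)
      _ ≤ 2 * ∑ i : Fin 3, A * (Ck * 𝒟) := by
          refine mul_le_mul_of_nonneg_left (Finset.sum_le_sum fun i _ => ?_) (by norm_num)
          exact (cellL2_smul_le_cellL2In L hA0 (hdχ0 i) (hAi i) (hdh i).continuousOn).trans
            (mul_le_mul_of_nonneg_left (hIHi i) hA0)
      _ = 6 * A * Ck * 𝒟 := by
          simp only [Finset.sum_const, Finset.card_univ, Fintype.card_fin, nsmul_eq_mul]; ring
  -- step 3c: the zeroth-order term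
  have step3c : cellL2 L (fun x => cylLap χ x • h x) ≤ B * ((Ck + CP) * 𝒟) :=
    (cellL2_smul_le_cellL2In L hB0 hLχ0 hB hh_s.continuousOn).trans (mul_le_mul_of_nonneg_left hIHh hB0)
  -- assemble
  have hM2 : 0 ≤ 9 * M ^ 2 := by positivity
  calc cellL2In L ρ₁ (cylWord (jcWord ((a :: a' :: vs').map some)) q)
      ≤ 9 * M ^ 2 * cellL2 L (cylLap v) := step1.trans step2
    _ ≤ 9 * M ^ 2 * ((Λ * M) ^ k * 𝒟 + 6 * A * Ck * 𝒟 + B * ((Ck + CP) * 𝒟)) :=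
        mul_le_mul_of_nonneg_left (step3.trans (add_le_add (add_le_add step3a step3b) step3c)) hM2
    _ = 9 * M ^ 2 * ((Λ * M) ^ k + 6 * A * Ck + B * (Ck + CP)) * 𝒟 := by ring


/-- **The interior estimate, all orders**: for `L > 0`, `M ≥ 1` and every `K` there is `C` such that
for every `q` smooth on the closed cylinder and `L`-periodic and every constant word of length
`1 ≤ n ≤ K + 2` with letters of norm `≤ M`,
`‖∂_{v₁}⋯∂_{v_n} q‖_{L²(cell ∩ {r < 1/2})} ≤ C (Σ_{m ≤ K} Σ_w cellL2 (X_{e∘w} Δ_K q) + cellL2 (∇q))`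
(`K + 1` applications of the step with the radii `ρ_k = 1/2 + 4⁻¹2⁻ᵏ`). [folklore] -/
theorem exists_cellL2In_half_le_all (K : ℕ) :
    ∃ C : ℝ, 0 ≤ C ∧ ∀ (q : ℝ³ → ℝ), ContDiffOn ℝ ∞ q 𝕂 → IsAxiallyPeriodic L q →
      ∀ vs : List ℝ³, 1 ≤ vs.length → vs.length ≤ K + 2 → (∀ v ∈ vs, ‖v‖ ≤ M) →
        cellL2In L (1 / 2) (cylWord (jcWord (vs.map some)) q) ≤
          C * (∑ m ∈ Finset.range (K + 1), ∑ w : Fin m → Fin (Module.finrank ℝ ℝ³),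
            cellL2 L (cylWord (jcWord (constWord fun j => Module.finBasis ℝ ℝ³ (w j))) (cylLap q)) + cellL2 L (cylGrad q)) := by
  have hM0 : 0 ≤ M := zero_le_one.trans hM1
  -- the radii
  set ρ : ℕ → ℝ := fun k => 1 / 2 + 4⁻¹ * (2⁻¹) ^ k with hρ
  have hρpos : ∀ k, 0 < ρ k := fun k => by simp only [hρ]; positivity
  have hρle : ∀ k, ρ k ≤ 1 := fun k => by
    simp only [hρ]
    have : (2⁻¹ : ℝ) ^ k ≤ 1 := pow_le_one₀ (by norm_num) (by norm_num)
    linarith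
  have hρlt : ∀ k, ρ (k + 1) < ρ k := fun k => by
    simp only [hρ, pow_succ]
    have : (0 : ℝ) < (2⁻¹ : ℝ) ^ k := by positivity
    nlinarith
  have hρhalf : ∀ k, 1 / 2 ≤ ρ k := fun k => by
    simp only [hρ]
    have : (0 : ℝ) ≤ 4⁻¹ * (2⁻¹ : ℝ) ^ k := by positivity
    linarith
  -- induction on the length, on the shrinking regions `{r < ρ k}`
  have main : ∀ k : ℕ, k ≤ K + 1 → ∃ C : ℝ, 0 ≤ C ∧ ∀ (q : ℝ³ → ℝ), ContDiffOn ℝ ∞ q 𝕂 → IsAxiallyPeriodic L q →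
      ∀ vs : List ℝ³, 1 ≤ vs.length → vs.length ≤ k + 1 → (∀ v ∈ vs, ‖v‖ ≤ M) →
        cellL2In L (ρ k) (cylWord (jcWord (vs.map some)) q) ≤
          C * (∑ m ∈ Finset.range (K + 1), ∑ w : Fin m → Fin (Module.finrank ℝ ℝ³),
            cellL2 L (cylWord (jcWord (constWord fun j => Module.finBasis ℝ ℝ³ (w j))) (cylLap q)) + cellL2 L (cylGrad q)) := by
    intro k
    induction k with
    | zero =>
      intro _
      refine ⟨M, hM0, fun q hq _ vs h1 h2 hl => ?_⟩
      obtain ⟨v, vs', rfl⟩ := List.exists_of_length_succ vs (by omega : vs.length = 0 + 1)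
      have hvs' : vs' = [] := List.eq_nil_of_length_eq_zero (by simpa using h2)
      subst hvs'
      refine (cellL2In_cylDeriv_le hM1 (ρ 0) hq (hl v (by simp))).trans ?_
      refine mul_le_mul_of_nonneg_left ?_ hM0
      have := Finset.sum_nonneg (s := Finset.range (K + 1)) fun m _ => Finset.sum_nonneg (s := Finset.univ)
        fun (w : Fin m → Fin (Module.finrank ℝ ℝ³)) _ =>
          cellL2_nonneg L (cylWord (jcWord (constWord fun j => Module.finBasis ℝ ℝ³ (w j))) (cylLap q))
      linarith
    | succ k ih =>
      intro hk
      obtain ⟨Ck, hCk0, hCk⟩ := ih (by omega)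
      obtain ⟨C, hC0, hC⟩ := cellL2In_step_all hL hM1 (hρpos (k + 1)) (hρlt k) (hρle k) K k (by omega) hCk0
      refine ⟨Ck + C, add_nonneg hCk0 hC0, fun q hq hqp => ?_⟩
      have hD0 : 0 ≤ (∑ m ∈ Finset.range (K + 1), ∑ w : Fin m → Fin (Module.finrank ℝ ℝ³),
          cellL2 L (cylWord (jcWord (constWord fun j => Module.finBasis ℝ ℝ³ (w j))) (cylLap q)) + cellL2 L (cylGrad q)) :=
        add_nonneg (Finset.sum_nonneg fun m _ => Finset.sum_nonneg fun w _ => cellL2_nonneg L _) (cellL2_nonneg L _)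
      exact cellL2In_combine (hρlt k).le k hCk0 hC0 hq hD0 (hCk q hq hqp) (hC q hq hqp (hCk q hq hqp))
  obtain ⟨C, hC0, hC⟩ := main (K + 1) le_rfl
  refine ⟨C, hC0, fun q hq hqp vs h1 h2 hl => ?_⟩
  exact (cellL2In_mono_radius L (hρhalf (K + 1)) (contDiffOn_cylWord_jcWord _ hq).continuousOn).trans
    (hC q hq hqp vs h1 (by omega) hl)

end Interior

end Literature.Analysis.FluidPDE
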